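import Summits.SmoothPoincare4.SmoothPoincare4.Theorems.ConvexBisectionAcyclicBisectionExistsPushedPrefixPush
import HarnessLib

/-!
# The pushed prefix sub-handlebody, IV: the global pushed embedding `jX₁' : X₁ → M'`
(file 4/4 = brick (ii-2) of the sub-goal T3b "the complement of the prefix sub-handlebody is the
other piece with the DUAL suffix handles" of stub `stub_steinRealisation` (NF6), line
`modp-braid-orbits` r11, crux `ConvexBisection.AcyclicBisectionExists`, item
stmt-SmoothPoincare4-10508; wave 4, lead c5, worker Y5)

Setting (general; Y6 instantiates with V5's standard form): `X₁` a compact 4-manifold with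
boundary, `g : ι → HandleAttachingMap 3 2 X₁` finitely many attaching maps, `D₂` multi-attachment
data of `X = X₁ ∪_g (handles)`, `jM : X → N` a smooth embedding into a Hausdorff 4-manifold
WITHOUT boundary (Milnor's gluing `G.d₂.Glued`, `jM = G.jM`).  With the push `sh` of file 3/4 and
`Ĵ₀ = jM ∘ D₂.jA` (read on `X₁` through the coercion chart of the open `X₁ ∖ ⋃ γⱼ`):

  `jX₁' := Ĵ₀ ∘ sh : X₁ → N`.

* `isImmersionAt_comp_jA_symm` — `Ĵ₀` is an immersion at every point off the circles;
* **`exists_pushedPrefixEmbedding`** — `jX₁'` is a smooth embedding `(𝓡∂ 4) → 𝓘(ℝ, ℝ⁴)`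
  (immersion at shallow points: `= Ĵ₀` nearby, `isOpen_shallow`; at tube points: the tube piece
  `jX₁' ∘ g_j = (Ĵ₀ ∘ g_j) ∘ S` is an immersion of the tube by file 2/4, transported along the open
  embedding `g_j`; injective; compact source), with the clauses
  (rng) `range jX₁' ⊆ range jM`;
  (a) `jX₁' p = jM (D₂.jA p)` at every `p` off the circles all of whose tube coordinates have
      `‖y_λ‖² ≤ 1 - 3κ²/4`;
  (b) tube formula in the handle chart: `jX₁' (g_j y) = jM (D₂.jB j b)` for the belt-piece point
      `b = α (S y)` (Kosinski's gluing relation);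
  (c) range in the `j`-th handle chart: `jM (D₂.jB j b) ∈ range jX₁' ↔ 0 < ‖b_λ‖² ∧ 0 ≤ H b`
      (`H = modelH κ δ`, Z2; from Z3's `image_selfPush_puncturedBall_modelH`);
  (c') range in the `X₁`-piece: `jM (D₂.jA a) ∈ range jX₁' ↔` every tube coordinate `y` of `a`
      has `0 ≤ H (α y)`;
* `helper_exists_pushedPrefixEmbedding` (registered; = the Y5/Y6 interface).

Everything here is proved; no named facts, no definitions.

## References
* J. Milnor, *Lectures on the h-cobordism theorem* (1965), §3. [MilnorHCobordism1965]
* A. A. Kosinski, *Differential Manifolds* (1993), VI §6–7. [Kosinski1993]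
* J. M. Lee, *Introduction to Smooth Manifolds* (2013), Thm. 4.15, Prop. 4.22. [LeeSmoothManifolds2013]
-/

noncomputable section

-- the prescribed namespace `Summit.<P>.<Sub>.…` duplicates `SmoothPoincare4` (P = Sub)
set_option linter.dupNamespace false

open scoped Manifold ContDiff Topology

namespace Summit.SmoothPoincare4.SmoothPoincare4.Theorems.AcyclicBisectionExists.ModpBraidOrbits

open Set Function Metric Filter
open Literature.Topology.FourManifolds Literature.Topology.FourManifolds.HandleAttachingMap

section Embedding

variable {X₁ : Type*} [TopologicalSpace X₁] [T2Space X₁] [ChartedSpace (EuclideanHalfSpace 4) X₁]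
  [IsManifold (𝓡∂ 4) ∞ X₁]
  {ι : Type*} [Finite ι] {g : ι → HandleAttachingMap 3 2 X₁}
  {X : Type*} [TopologicalSpace X] [ChartedSpace (EuclideanHalfSpace 4) X] [IsManifold (𝓡∂ 4) ∞ X]
  {N : Type*} [TopologicalSpace N] [ChartedSpace (EuclideanSpace ℝ (Fin 4)) N] [IsManifold (𝓡 4) ∞ N]

omit [IsManifold (𝓡 4) ∞ N] in
/-- **`Ĵ₀ = jM ∘ D₂.jA`, read on `X₁` through the coercion chart of the open `X₁ ∖ ⋃ γⱼ`, is an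
immersion at every point off the circles** (`jM` is an immersion; precompose with the open
embedding `D₂.jA` and with the inverse of the coercion chart). [cite: LeeSmoothManifolds2013, Prop. 4.22] -/
theorem isImmersionAt_comp_jA_symm (D₂ : MultiAttachmentData g (𝓡∂ 4) X) {jM : X → N}
    (hjM : Manifold.IsSmoothEmbedding (𝓡∂ 4) 𝓘(ℝ, EuclideanSpace ℝ (Fin 4)) ∞ jM)
    (hne : Nonempty ↥(coresComplement g)) {p : X₁} (hp : p ∈ coresComplement g) :
    Manifold.IsImmersionAt (𝓡∂ 4) (𝓡 4) ∞
      (fun q : X₁ => jM (D₂.jA (((coresComplement g).openPartialHomeomorphSubtypeCoe hne).symm q))) p := by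
  haveI := hne
  set c := (coresComplement g).openPartialHomeomorphSubtypeCoe hne with hc
  obtain ⟨F, _, _, hF⟩ := hjM.isImmersion
  have h1 : Manifold.IsImmersionAtOfComplement F (𝓡∂ 4) (𝓡 4) ∞ (jM ∘ D₂.jA) (c.symm p) :=
    (hF (D₂.jA (c.symm p))).comp_openPartialHomeomorph (openEmbeddingChart D₂.hjA D₂.hjAo)
      (contMDiffOn_openEmbeddingChart D₂.hjA D₂.hjAo) (contMDiffOn_openEmbeddingChart_symm D₂.hjA D₂.hjAo)
      (by rw [openEmbeddingChart_source]; exact mem_univ _)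
  have hΦ : ContMDiffOn (𝓡∂ 4) (𝓡∂ 4) ∞ c.symm c.symm.source :=
    contMDiffOn_openPartialHomeomorphSubtypeCoe_symm _ hne
  have hΦ' : ContMDiffOn (𝓡∂ 4) (𝓡∂ 4) ∞ c.symm.symm c.symm.target := by
    rw [OpenPartialHomeomorph.symm_symm, OpenPartialHomeomorph.symm_target]
    exact contMDiffOn_openPartialHomeomorphSubtypeCoe _ hne
  have hsrc : p ∈ c.symm.source := by
    rw [OpenPartialHomeomorph.symm_source, TopologicalSpace.Opens.openPartialHomeomorphSubtypeCoe_target]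
    exact hp
  exact (h1.comp_openPartialHomeomorph c.symm hΦ hΦ' hsrc).isImmersionAt

omit [IsManifold (𝓡∂ 4) ∞ X₁] in
/-- The inverse coercion chart on a point of the open subset is that point. [folklore] -/
theorem openPartialHomeomorphSubtypeCoe_symm_apply_of_mem (hne : Nonempty ↥(coresComplement g))
    {q : X₁} (hq : q ∈ coresComplement g) :
    ((coresComplement g).openPartialHomeomorphSubtypeCoe hne).symm q = ⟨q, hq⟩ := by
  have := ((coresComplement g).openPartialHomeomorphSubtypeCoe hne).left_inv
    (show (⟨q, hq⟩ : ↥(coresComplement g)) ∈ ((coresComplement g).openPartialHomeomorphSubtypeCoe hne).source by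
      rw [TopologicalSpace.Opens.openPartialHomeomorphSubtypeCoe_source]; exact mem_univ _)
  rwa [TopologicalSpace.Opens.openPartialHomeomorphSubtypeCoe_coe] at this

omit [IsManifold (𝓡∂ 4) ∞ X₁] [Finite ι] in
/-- A tube point, as a vector: `‖y‖ ≤ 1`, `y_λ ≠ 0`, `0 < ‖y_λ‖²`. [folklore] -/
theorem tube_coe_mem (y : ↥(handleTube 3 2)) :
    ‖(y : EuclideanSpace ℝ (Fin 4))‖ ≤ 1 ∧ lamPart (y : EuclideanSpace ℝ (Fin 4)) ≠ 0 ∧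
      0 < sOf (y : EuclideanSpace ℝ (Fin 4)) := by
  have h0 : 0 < sOf (y : EuclideanSpace ℝ (Fin 4)) := by
    rw [sOf_eq_lamSq]; exact lt_of_le_of_ne (lamSq_nonneg 2 _) (Ne.symm y.2)
  exact ⟨mem_closedBall_zero_iff.1 y.1.2, PushModel.sOf_pos_iff.1 h0, h0⟩

open PushModel in
/-- **THE GLOBAL PUSHED EMBEDDING OF THE PREFIX SUB-HANDLEBODY** (brick (ii-2) of T3b; see the
module docstring for the clauses). [cite: MilnorHCobordism1965, §3] -/
theorem exists_pushedPrefixEmbedding [CompactSpace X₁] [T2Space N] (D₂ : MultiAttachmentData g (𝓡∂ 4) X)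
    {jM : X → N} (hjM : Manifold.IsSmoothEmbedding (𝓡∂ 4) 𝓘(ℝ, EuclideanSpace ℝ (Fin 4)) ∞ jM)
    {κ δ : ℝ} (hκ : 0 < κ) (hκ2 : κ ≤ 1 / 2) (hδ : 0 < δ) (hδ2 : δ ≤ 1 / 2) :
    ∃ jX₁' : X₁ → N,
      Manifold.IsSmoothEmbedding (𝓡∂ 4) 𝓘(ℝ, EuclideanSpace ℝ (Fin 4)) ∞ jX₁' ∧
      range jX₁' ⊆ range jM ∧
      (∀ (p : X₁) (hp : p ∈ coresComplement g),
        (∀ (j : ι) (y : ↥(handleTube 3 2)), (g j).toFun y = p →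
          ‖lamPart (y : EuclideanSpace ℝ (Fin 4))‖ ^ 2 ≤ 1 - 3 * κ ^ 2 / 4) →
        jX₁' p = jM (D₂.jA ⟨p, hp⟩)) ∧
      (∀ (j : ι) (y : ↥(handleTube 3 2)) (b : ↥(beltPiece 3 2)),
        (b : EuclideanSpace ℝ (Fin 4)) = handleInversion 2 (selfPush κ δ (y : EuclideanSpace ℝ (Fin 4))) →
        jX₁' ((g j).toFun y) = jM (D₂.jB j b)) ∧
      (∀ (j : ι) (b : ↥(beltPiece 3 2)),
        jM (D₂.jB j b) ∈ range jX₁' ↔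
          0 < ‖lamPart (b : EuclideanSpace ℝ (Fin 4))‖ ^ 2 ∧ 0 ≤ modelH κ δ (b : EuclideanSpace ℝ (Fin 4))) ∧
      (∀ a : ↥(coresComplement g),
        jM (D₂.jA a) ∈ range jX₁' ↔
          ∀ (j : ι) (y : ↥(handleTube 3 2)), (g j).toFun y = (a : X₁) →
            0 ≤ modelH κ δ (handleInversion 2 (y : EuclideanSpace ℝ (Fin 4)))) := by
  classical
  have hfin : Module.finrank ℝ (EuclideanSpace ℝ (Fin 4)) = Module.finrank ℝ (EuclideanSpace ℝ (Fin 4)) := rfl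
  have himage := image_selfPush_puncturedBall_modelH hκ hκ2 hδ hδ2
  -- the degenerate case `X₁ = ∅`
  rcases isEmpty_or_nonempty X₁ with hX | hX
  · obtain ⟨θ, hθ⟩ := (NormedSpace.sphere_nonempty.2 zero_le_one :
      (Metric.sphere (0 : EuclideanSpace ℝ (Fin 2)) 1).Nonempty)
    have hι : ∀ j : ι, False := fun j => hX.false ((g j).toFun (coreTubePt ⟨θ, hθ⟩))
    refine ⟨fun p => hX.elim p, ⟨Manifold.isImmersion_of_isImmersionAt_of_finrank_eq hfin fun p => hX.elim p, ?_⟩,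
      ?_, fun p => hX.elim p, fun j => (hι j).elim, fun j => (hι j).elim, fun a => hX.elim (a : X₁)⟩
    · have hc : Continuous fun p : X₁ => (hX.elim p : N) := ⟨fun s _ => by
        rw [Set.eq_empty_of_isEmpty ((fun p : X₁ => (hX.elim p : N)) ⁻¹' s)]; exact isOpen_empty⟩
      exact (hc.isClosedEmbedding fun p => hX.elim p).isEmbedding
    · rintro _ ⟨p, -⟩; exact hX.elim p
  -- the push and the map
  have hne : Nonempty ↥(coresComplement g) := by
    obtain ⟨p⟩ := hX
    obtain ⟨sh, -, -, hmem, -⟩ := exists_prefixPush (g := g) hκ hκ2 hδ hδ2 (by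
      intro i j hij
      exact (MultiAttachmentData.disjoint D₂) hij)
    exact ⟨⟨sh p, hmem p⟩⟩
  obtain ⟨sh, hoff, htube, hmem, hinj, hfib, hshallow⟩ := exists_prefixPush (g := g) hκ hκ2 hδ hδ2 D₂.disjoint
  set c := (coresComplement g).openPartialHomeomorphSubtypeCoe hne with hc
  set J₀ : X₁ → N := fun q => jM (D₂.jA (c.symm q)) with hJ₀_def
  have hJ₀ : ∀ (q : X₁) (hq : q ∈ coresComplement g), J₀ q = jM (D₂.jA ⟨q, hq⟩) := fun q hq => by
    show jM (D₂.jA (c.symm q)) = _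
    rw [hc, openPartialHomeomorphSubtypeCoe_symm_apply_of_mem hne hq]
  have hshallow' : ∀ p : X₁, (∀ (j : ι) (y : ↥(handleTube 3 2)), (g j).toFun y = p →
      lamSq 2 (y : EuclideanSpace ℝ (Fin 4)) < 1 - 3 * κ ^ 2 / 4) → sh p = p := fun p h =>
    hshallow p fun j y he => (h j y he).le
  -- the tube formula in the handle chart (clause (b))
  have hB : ∀ (j : ι) (y : ↥(handleTube 3 2)) (b : ↥(beltPiece 3 2)),
      (b : EuclideanSpace ℝ (Fin 4)) = handleInversion 2 (selfPush κ δ (y : EuclideanSpace ℝ (Fin 4))) →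
      J₀ (sh ((g j).toFun y)) = jM (D₂.jB j b) := by
    intro j y b hb
    obtain ⟨y', hy', h1⟩ := exists_tube_coe_eq_selfPush hκ hκ2 hδ hδ2 y
    have hmem' : (g j).toFun y' ∈ coresComplement g := (apply_mem_coresComplement_iff D₂.disjoint j y').2 h1
    rw [htube j y y' hy', hJ₀ _ hmem']
    congr 1
    exact (D₂.glue j ⟨(g j).toFun y', hmem'⟩ b).2 ⟨y', h1, by rw [hb, hy'], rfl⟩
  -- immersion at every point
  have himm : ∀ p, Manifold.IsImmersionAt (𝓡∂ 4) (𝓡 4) ∞ (fun p => J₀ (sh p)) p := by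
    intro p
    by_cases hA : ∀ (j : ι) (y : ↥(handleTube 3 2)), (g j).toFun y = p →
        lamSq 2 (y : EuclideanSpace ℝ (Fin 4)) < 1 - 3 * κ ^ 2 / 4
    · -- shallow point: `= Ĵ₀` nearby
      have hpA : p ∈ coresComplement g := by rw [← hshallow' p hA]; exact hmem p
      refine (isImmersionAt_comp_jA_symm D₂ hjM hne hpA).congr_of_eventuallyEq ?_
      filter_upwards [(isOpen_shallow hκ hκ2).mem_nhds hA] with q hq
      show J₀ q = J₀ (sh q)
      rw [hshallow' q hq]
    · -- tube point
      push Not at hA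
      obtain ⟨j, y₀, rfl, -⟩ := hA
      haveI : Nonempty ↥(handleTube 3 2) := ⟨y₀⟩
      set e := openEmbeddingChart (g j).isSmoothEmbedding (g j).isOpen_range with he
      have hJ : ∀ y : ↥(handleTube 3 2), lamSq 2 (y : EuclideanSpace ℝ (Fin 4)) ≠ 1 →
          Manifold.IsImmersionAt (𝓡∂ 4) (𝓡 4) ∞ (J₀ ∘ (g j).toFun) y := by
        intro y hy
        have h2 := isImmersionAt_comp_jA_symm D₂ hjM hne ((apply_mem_coresComplement_iff D₂.disjoint j y).2 hy)
        exact (h2.isImmersionAtOfComplement_complement.comp_openPartialHomeomorph e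
          (contMDiffOn_openEmbeddingChart _ _) (contMDiffOn_openEmbeddingChart_symm _ _)
          (by rw [he, openEmbeddingChart_source]; exact mem_univ _)).isImmersionAt
      have hK : ∀ y y' : ↥(handleTube 3 2),
          (y' : EuclideanSpace ℝ (Fin 4)) = selfPush κ δ (y : EuclideanSpace ℝ (Fin 4)) →
          ((fun p => J₀ (sh p)) ∘ (g j).toFun) y = (J₀ ∘ (g j).toFun) y' := by
        intro y y' hy'
        show J₀ (sh ((g j).toFun y)) = J₀ ((g j).toFun y')
        rw [htube j y y' hy']
      have hKimm := isImmersionAt_of_eq_comp_selfPush hκ hκ2 hδ hδ2 hJ hK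
      have hΦ : ContMDiffOn (𝓡∂ 4) (𝓡∂ 4) ∞ e.symm e.symm.source := contMDiffOn_openEmbeddingChart_symm _ _
      have hΦ' : ContMDiffOn (𝓡∂ 4) (𝓡∂ 4) ∞ e.symm.symm e.symm.target := by
        rw [OpenPartialHomeomorph.symm_symm, OpenPartialHomeomorph.symm_target]
        exact contMDiffOn_openEmbeddingChart _ _
      have hsrc : (g j).toFun y₀ ∈ e.symm.source := by
        rw [OpenPartialHomeomorph.symm_source, he, openEmbeddingChart_target]; exact mem_range_self _
      have h3 := ((hKimm (e.symm ((g j).toFun y₀))).isImmersionAtOfComplement_complement.comp_openPartialHomeomorph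
        e.symm hΦ hΦ' hsrc).isImmersionAt
      refine h3.congr_of_eventuallyEq ?_
      filter_upwards [(g j).isOpen_range.mem_nhds (mem_range_self y₀)] with q hq
      show J₀ (sh ((g j).toFun (e.symm q))) = J₀ (sh q)
      rw [he, apply_openEmbeddingChart_symm _ _ hq]
  have hcont : Continuous fun p => J₀ (sh p) := continuous_iff_continuousAt.2 fun p => (himm p).continuousAt
  have hinjX : Injective fun p => J₀ (sh p) := by
    intro p q hpq
    have h1 : D₂.jA (c.symm (sh p)) = D₂.jA (c.symm (sh q)) := hjM.isEmbedding.injective hpq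
    have h2 := D₂.injective_jA h1
    rw [hc, openPartialHomeomorphSubtypeCoe_symm_apply_of_mem hne (hmem p),
      openPartialHomeomorphSubtypeCoe_symm_apply_of_mem hne (hmem q)] at h2
    exact hinj (congrArg Subtype.val h2)
  -- pushed tube points, as vectors
  have hfib' : ∀ (p : X₁) (j : ι) (y₀ : ↥(handleTube 3 2)), sh p = (g j).toFun y₀ →
      0 ≤ modelH κ δ (handleInversion 2 (y₀ : EuclideanSpace ℝ (Fin 4))) := by
    intro p j y₀ he
    obtain ⟨y, -, hy⟩ := hfib p j y₀ he
    have : (y₀ : EuclideanSpace ℝ (Fin 4)) ∈ selfPush κ δ '' {y | ‖y‖ ≤ 1 ∧ lamPart y ≠ 0} :=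
      ⟨y, ⟨(tube_coe_mem y).1, (tube_coe_mem y).2.1⟩, hy.symm⟩
    rw [himage] at this
    exact this.2.2.2
  refine ⟨fun p => J₀ (sh p), ⟨Manifold.isImmersion_of_isImmersionAt_of_finrank_eq hfin himm,
    (hcont.isClosedEmbedding hinjX).isEmbedding⟩, ?_, fun p hp h => ?_, hB, fun j b => ⟨?_, ?_⟩, fun a => ⟨?_, ?_⟩⟩
  · rintro _ ⟨p, rfl⟩; exact ⟨_, rfl⟩
  · -- (a)
    show J₀ (sh p) = _
    rw [hshallow p fun j y he => by rw [← norm_lamPart_sq]; exact h j y he, hJ₀ p hp]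
  · -- (c), `→`
    rintro ⟨p, hp⟩
    have h1 : D₂.jA (c.symm (sh p)) = D₂.jB j b := hjM.isEmbedding.injective hp
    rw [hc, openPartialHomeomorphSubtypeCoe_symm_apply_of_mem hne (hmem p)] at h1
    obtain ⟨y₀, h1', hb, he⟩ := (D₂.glue j _ b).1 h1
    obtain ⟨y, -, hy⟩ := hfib p j y₀ he
    have hmemS : (y₀ : EuclideanSpace ℝ (Fin 4)) ∈ selfPush κ δ '' {y | ‖y‖ ≤ 1 ∧ lamPart y ≠ 0} :=
      ⟨y, ⟨(tube_coe_mem y).1, (tube_coe_mem y).2.1⟩, hy.symm⟩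
    rw [himage] at hmemS
    obtain ⟨-, h0, hl1, hH⟩ := hmemS
    refine ⟨?_, by rw [hb]; exact hH⟩
    show 0 < sOf (b : EuclideanSpace ℝ (Fin 4))
    rw [hb, sOf_handleInversion h0 hl1.le]
    linarith
  · -- (c), `←`
    rintro ⟨h0b, hHb⟩
    change 0 < sOf (b : EuclideanSpace ℝ (Fin 4)) at h0b
    have hb1 : ‖(b : EuclideanSpace ℝ (Fin 4))‖ ≤ 1 := mem_closedBall_zero_iff.1 b.1.2
    have hbl : sOf (b : EuclideanSpace ℝ (Fin 4)) < 1 := by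
      rw [sOf_eq_lamSq]
      exact lt_of_le_of_ne (lamSq_le_one hb1) b.2
    set x := handleInversion 2 (b : EuclideanSpace ℝ (Fin 4)) with hx
    have hx1 : ‖x‖ ≤ 1 := norm_handleInversion_le_one_sOf hb1 h0b hbl
    have hsx : sOf x = 1 - sOf (b : EuclideanSpace ℝ (Fin 4)) := sOf_handleInversion h0b hbl.le
    have hxx : handleInversion 2 x = b := handleInversion_handleInversion_sOf h0b hbl
    have hxmem : x ∈ selfPush κ δ '' {y | ‖y‖ ≤ 1 ∧ lamPart y ≠ 0} := by
      rw [himage]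
      exact ⟨hx1, by rw [hsx]; linarith, by rw [hsx]; linarith, by rw [hxx]; exact hHb⟩
    obtain ⟨y, ⟨hy1, hy0⟩, hyx⟩ := hxmem
    set yT : ↥(handleTube 3 2) := ⟨⟨y, mem_closedBall_zero_iff.2 hy1⟩, by
      rw [mem_handleTube, ← sOf_eq_lamSq]; exact (sOf_pos_iff.2 hy0).ne'⟩ with hyT
    exact ⟨(g j).toFun yT, hB j yT b (by rw [show selfPush κ δ (yT : EuclideanSpace ℝ (Fin 4)) = x from hyx, hxx])⟩
  · -- (c'), `→`
    rintro ⟨p, hp⟩ j y he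
    have h1 : c.symm (sh p) = a := D₂.injective_jA (hjM.isEmbedding.injective hp)
    rw [hc, openPartialHomeomorphSubtypeCoe_symm_apply_of_mem hne (hmem p)] at h1
    have h2 : sh p = (a : X₁) := congrArg Subtype.val h1
    exact hfib' p j y (h2.trans he.symm)
  · -- (c'), `←`
    intro h
    by_cases ha : ∃ (j : ι) (y : ↥(handleTube 3 2)), (g j).toFun y = (a : X₁)
    · obtain ⟨j, y, hy⟩ := ha
      have hl1 : lamSq 2 (y : EuclideanSpace ℝ (Fin 4)) ≠ 1 :=
        (apply_mem_coresComplement_iff D₂.disjoint j y).1 (hy ▸ a.2)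
      obtain ⟨hy1, hy0, hs0⟩ := tube_coe_mem y
      have hs1 : sOf (y : EuclideanSpace ℝ (Fin 4)) < 1 := by
        rw [sOf_eq_lamSq]; exact lt_of_le_of_ne (lamSq_le_one hy1) hl1
      have hymem : (y : EuclideanSpace ℝ (Fin 4)) ∈ selfPush κ δ '' {y | ‖y‖ ≤ 1 ∧ lamPart y ≠ 0} := by
        rw [himage]; exact ⟨hy1, hs0, hs1, h j y hy⟩
      obtain ⟨y', ⟨hy'1, hy'0⟩, hy'⟩ := hymem
      set yT : ↥(handleTube 3 2) := ⟨⟨y', mem_closedBall_zero_iff.2 hy'1⟩, by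
        rw [mem_handleTube, ← sOf_eq_lamSq]; exact (sOf_pos_iff.2 hy'0).ne'⟩ with hyT
      refine ⟨(g j).toFun yT, ?_⟩
      show J₀ (sh ((g j).toFun yT)) = jM (D₂.jA a)
      rw [htube j yT y hy'.symm, hJ₀ _ (hy ▸ a.2 : (g j).toFun y ∈ coresComplement g)]
      congr 2
      exact Subtype.ext hy
    · push Not at ha
      refine ⟨a, ?_⟩
      show J₀ (sh a) = jM (D₂.jA a)
      rw [hoff a ha, hJ₀ a a.2]

end Embedding

/-- **Registered helper `helper_exists_pushedPrefixEmbedding` = brick (ii-2) of T3b (sub-goal of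
NF6 `stub_steinRealisation`, wave 4, lead c5): the global pushed embedding of the prefix
sub-handlebody** — for multi-attachment data `D₂` of `X = X₁ ∪_g (handles)` over a compact `X₁` and
a smooth embedding `jM` of `X` into a Hausdorff 4-manifold without boundary, a smooth embedding
`jX₁' : X₁ → N` through `jM` which is `jM ∘ D₂.jA` off the deep tube ends, is `y ↦ jM (D₂.jB j (α (S y)))`
on the `j`-th tube (`S = selfPush κ δ`), and whose range is `{0 < ‖b_λ‖², 0 ≤ modelH κ δ b}` in each
handle chart. [cite: MilnorHCobordism1965, §3] -/
theorem helper_exists_pushedPrefixEmbedding : ∀ {X₁ : Type*} [TopologicalSpace X₁] [T2Space X₁] [ChartedSpace (EuclideanHalfSpace 4) X₁] [IsManifold (𝓡∂ 4) ∞ X₁] {ι : Type*} [Finite ι] {g : ι → Literature.Topology.FourManifolds.HandleAttachingMap 3 2 X₁} {X : Type*} [TopologicalSpace X] [ChartedSpace (EuclideanHalfSpace 4) X] [IsManifold (𝓡∂ 4) ∞ X] {N : Type*} [TopologicalSpace N] [ChartedSpace (EuclideanSpace ℝ (Fin 4)) N] [IsManifold (𝓡 4) ∞ N] [CompactSpace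 X₁] [T2Space N] (D₂ : Literature.Topology.FourManifolds.HandleAttachingMap.MultiAttachmentData g (𝓡∂ 4) X) {jM : X → N}, Manifold.IsSmoothEmbedding (𝓡∂ 4) 𝓘(ℝ, EuclideanSpace ℝ (Fin 4)) ∞ jM → ∀ {κ δ : ℝ}, 0 < κ → κ ≤ 1 / 2 → 0 < δ → δ ≤ 1 / 2 → ∃ jX₁' : X₁ → N, Manifold.IsSmoothEmbedding (𝓡∂ 4) 𝓘(ℝ, EuclideanSpace ℝ (Fin 4)) ∞ jX₁' ∧ Set.range jX₁' ⊆ Set.range jM ∧ (∀ (p : X₁) (hp : p ∈ Literature.Topology.FourManifolds.HandleAttachingMap.coresComplement g), (∀ (j : ι) (y : ↥(Literature.Topology.FourManifolds.handleTube 3 2)), (g j).toFun y = p → ‖Literature.Topology.FourManifolds.lamPart (y : EuclideanSpace ℝ (Fin 4))‖ ^ 2 ≤ 1 - 3 * κ ^ 2 / 4) → jX₁' p = jM (D₂.jA ⟨p, hp⟩)) ∧ (∀ (j : ι) (y : ↥(Literature.Topology.FourManifolds.handleTube 3 2)) (b : ↥(Literature.Topology.FourManifolds.beltPiece 3 2)),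 (b : EuclideanSpace ℝ (Fin 4)) = Literature.Topology.FourManifolds.handleInversion 2 (Summit.SmoothPoincare4.SmoothPoincare4.Theorems.AcyclicBisectionExists.ModpBraidOrbits.PushModel.selfPush κ δ (y : EuclideanSpace ℝ (Fin 4))) → jX₁' ((g j).toFun y) = jM (D₂.jB j b)) ∧ (∀ (j : ι) (b : ↥(Literature.Topology.FourManifolds.beltPiece 3 2)), jM (D₂.jB j b) ∈ Set.range jX₁' ↔ 0 < ‖Literature.Topology.FourManifolds.lamPart (b : EuclideanSpace ℝ (Fin 4))‖ ^ 2 ∧ 0 ≤ Summit.SmoothPoincare4.SmoothPoincare4.Theorems.AcyclicBisectionExists.ModpBraidOrbits.modelH κ δ (b : EuclideanSpace ℝ (Fin 4))) ∧ (∀ a : ↥(Literature.Topology.FourManifolds.HandleAttachingMap.coresComplement g), jM (D₂.jA a) ∈ Set.range jX₁' ↔ ∀ (j : ι) (y : ↥(Literature.Topology.FourManifolds.handleTube 3 2)), (g j).toFun y = (a : X₁) → 0 ≤ Summit.SmoothPoincare4.SmoothPoincare4.Theorems.AcyclicBisectionExists.ModpBraidOrbits.modelH κ δ (Literature.Topology.FourManifolds.handleInversion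 2 (y : EuclideanSpace ℝ (Fin 4)))) := by
  intro X₁ _ _ _ _ ι _ g X _ _ _ N _ _ _ _ _ D₂ jM hjM κ δ hκ hκ2 hδ hδ2
  exact exists_pushedPrefixEmbedding D₂ hjM hκ hκ2 hδ hδ2

end Summit.SmoothPoincare4.SmoothPoincare4.Theorems.AcyclicBisectionExists.ModpBraidOrbits

end
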